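import Summits.CriticalPhenomena.PercolationContinuityZ3.Theorems.PercNearOneGluingNoHeavyLowerTailForestRayleighContractMain
import Summits.CriticalPhenomena.PercolationContinuityZ3.Theorems.PercNearOneGluingNoHeavyLowerTailForestRayleighKFour
import Summits.CriticalPhenomena.PercolationContinuityZ3.Theorems.PercNearOneGluingNoHeavyLowerTailForestRayleighRelabelClass
import HarnessLib

/-!
# Weighted forest negative correlation — graphs on five vertices: every pinned instance reduces to `K₄`

On `Fin 5`, an instance `(D;K;e,f)` of the Rayleigh inequality with `K ≠ ∅` has a pinned edge
`ab`; contracting it (`lsm_of_pinned_contract`) lands in the complete graph on the four vertices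
`≠ b`, which has the Rayleigh property (`forestsW_rayleigh_K4`). Hence
`lsm_of_pinned_fin5`: **every loop-free instance on five vertices with a pinned edge satisfies
`(R)`**, whatever the graph — the Rayleigh property of a graph on five vertices reduces to its
instances with `K = ∅`, i.e. (by deletion) to the *top cells* of its subgraphs (`…FiveTop*`).
Theorems only; no definitions, no `sorry`.
-/

open Finset SimpleGraph
open scoped Classical

namespace Summit.CriticalPhenomena.PercolationContinuityZ3.Theorems.ForestRayleigh

/-- The complete graph on the four vertices of `Fin 5` other than `b` (the non-loops avoiding `b`)
has the Rayleigh property. [`forestsW_rayleigh_K4` on `b+1, …, b+4`] -/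
theorem rayleigh_K4_compl_fin5 (b : Fin 5) :
    ∀ (w : Sym2 (Fin 5) → ℝ), (∀ x, 0 ≤ w x) → ∀ (D K : Finset (Sym2 (Fin 5))) (e f : Sym2 (Fin 5)),
      D ∪ insert e (insert f K) ⊆ ((Finset.univ : Finset (Sym2 (Fin 5))).filter (fun z => ¬z.IsDiag ∧ b ∉ z)) → Disjoint D K → e ∉ D → e ∉ K → f ∉ D →
      f ∉ K → e ≠ f →
      (∑ G ∈ D.powerset.filter (fun G =>
        (fromEdgeSet ((G ∪ (insert e (insert f (K))) : Finset (Sym2 (Fin 5))) : Set (Sym2 (Fin 5)))).IsAcyclic), ∏ y ∈ G, w y) *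
        (∑ G ∈ D.powerset.filter (fun G =>
        (fromEdgeSet ((G ∪ (K) : Finset (Sym2 (Fin 5))) : Set (Sym2 (Fin 5)))).IsAcyclic), ∏ y ∈ G, w y) ≤
      (∑ G ∈ D.powerset.filter (fun G =>
        (fromEdgeSet ((G ∪ (insert e (K)) : Finset (Sym2 (Fin 5))) : Set (Sym2 (Fin 5)))).IsAcyclic), ∏ y ∈ G, w y) *
        (∑ G ∈ D.powerset.filter (fun G =>
        (fromEdgeSet ((G ∪ (insert f (K)) : Finset (Sym2 (Fin 5))) : Set (Sym2 (Fin 5)))).IsAcyclic), ∏ y ∈ G, w y) := by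
  have hsub : ∀ b : Fin 5, ((Finset.univ : Finset (Sym2 (Fin 5))).filter (fun z => ¬z.IsDiag ∧ b ∉ z)) ⊆
      ({s(b + 1, b + 2), s(b + 1, b + 3), s(b + 1, b + 4), s(b + 2, b + 3), s(b + 2, b + 4), s(b + 3, b + 4)} : Finset (Sym2 (Fin 5))) := by
    decide
  have h12 : ∀ b : Fin 5, b + 1 ≠ b + 2 := by decide
  have h13 : ∀ b : Fin 5, b + 1 ≠ b + 3 := by decide
  have h14 : ∀ b : Fin 5, b + 1 ≠ b + 4 := by decide
  have h23 : ∀ b : Fin 5, b + 2 ≠ b + 3 := by decide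
  have h24 : ∀ b : Fin 5, b + 2 ≠ b + 4 := by decide
  have h34 : ∀ b : Fin 5, b + 3 ≠ b + 4 := by decide
  exact rayleigh_mono _ _ (hsub b) (forestsW_rayleigh_K4 (b + 1) (b + 2) (b + 3) (b + 4) (h12 b) (h13 b)
    (h14 b) (h23 b) (h24 b) (h34 b))

/-- **Every instance on five vertices with a pinned edge satisfies `(R)`** (all activities):
contract the pinned edge into the complete graph on the other four vertices.
[`lsm_of_pinned_contract` + `forestsW_rayleigh_K4`] -/
theorem lsm_of_pinned_fin5 (w : Sym2 (Fin 5) → ℝ) (hw : ∀ x, 0 ≤ w x) (D K : Finset (Sym2 (Fin 5)))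
    (e f : Sym2 (Fin 5)) (hDK : Disjoint D K) (heD : e ∉ D) (heK : e ∉ K) (hfD : f ∉ D) (hfK : f ∉ K)
    (hef : e ≠ f) (hL : ∀ z ∈ D ∪ insert e (insert f K), ¬z.IsDiag) (hK : K.Nonempty) :
    (∑ G ∈ D.powerset.filter (fun G =>
        (fromEdgeSet ((G ∪ (insert e (insert f (K))) : Finset (Sym2 (Fin 5))) : Set (Sym2 (Fin 5)))).IsAcyclic), ∏ y ∈ G, w y) *
      (∑ G ∈ D.powerset.filter (fun G =>
        (fromEdgeSet ((G ∪ (K) : Finset (Sym2 (Fin 5))) : Set (Sym2 (Fin 5)))).IsAcyclic), ∏ y ∈ G, w y) ≤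
    (∑ G ∈ D.powerset.filter (fun G =>
        (fromEdgeSet ((G ∪ (insert e (K)) : Finset (Sym2 (Fin 5))) : Set (Sym2 (Fin 5)))).IsAcyclic), ∏ y ∈ G, w y) *
      (∑ G ∈ D.powerset.filter (fun G =>
        (fromEdgeSet ((G ∪ (insert f (K)) : Finset (Sym2 (Fin 5))) : Set (Sym2 (Fin 5)))).IsAcyclic), ∏ y ∈ G, w y) := by
  obtain ⟨k, hk⟩ := hK
  revert hk
  refine Sym2.ind (fun a b => ?_) k
  intro hk
  have hkE : s(a, b) ∈ D ∪ insert e (insert f K) := by simp [hk]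
  have hab : a ≠ b := fun h => hL _ hkE (Sym2.mk_isDiag_iff.2 h)
  refine lsm_of_pinned_contract _ (rayleigh_K4_compl_fin5 b) a b hab w hw D K e f hDK heD heK hfD hfK
    hef (by rw [Sym2.eq_swap]; exact hk) hL ?_ ?_
  · intro z hz hbz
    exact Finset.mem_filter.2 ⟨Finset.mem_univ _, hL z hz, hbz⟩
  · intro y hy hya
    have hby : b ≠ y := fun h => hL _ hy (Sym2.mk_isDiag_iff.2 h)
    refine Finset.mem_filter.2 ⟨Finset.mem_univ _, fun h => hya (Sym2.mk_isDiag_iff.1 h).symm, ?_⟩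
    rw [Sym2.mem_iff, not_or]
    exact ⟨hab.symm, hby⟩

end Summit.CriticalPhenomena.PercolationContinuityZ3.Theorems.ForestRayleigh
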